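import Literature.Computability.QuantumComplexity.BQPCollapsingOracle
import Literature.Computability.QuantumComplexity.RandomOracleCylinders
import HarnessLib

/-!
# Oracle locality of quantum circuits; the acceptance probability is measurable in the random oracle

Toolkit for random-oracle statements about quantum oracle machines (Aaronson–Ambainis 2014,
Thm. 23 = Thm. 7 (iii): `Barriers/QuantumAdvantage/RandomOracleMethodThm23.lean`). In the tree's
circuit model (`Cryptography/QuantumCircuit.lean`) an oracle gate on `k` query wires applies the XOR
query of the language `A` to the basis strings of length exactly `k`, so a circuit on `N` wires
depends on the oracle only through the strings of length `< N` — the tree's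
`oracleGate_congr` / `QGate.toMatrix_congr` / `QCircuit.toMatrix_congr` / `QCircuit.acceptProb_congr`
of `BQPCollapsingOracle.lean` (Bernstein–Vazirani 1997, §8). This file adds the family-level and
measure-theoretic consequences:

* `QCircuitFamily.acceptProbOn_congr` — `F.acceptProbOn A x` (width `N = |x| + ancillas |x|`)
  depends on `A` only through the strings of length `< N`;
* `shortStrings N` (the finite set of those strings), `acceptProbOn_eq_of_restrictBool`,
  **`measurable_acceptProbOn`** (`A ↦ F.acceptProbOn A x` is measurable for the random oracle
  `randomOracleMeasure`: it factors through `restrictBool (shortStrings N)` of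
  `RandomOracleCylinders.lean`) and `isDetermined_acceptProbOn` (events defined through the
  acceptance probability are `IsDetermined (shortStrings N)`).

## References

* E. Bernstein, U. Vazirani, *Quantum complexity theory*, SIAM J. Comput. 26 (1997), §8 (oracle
  quantum Turing machines) [BernsteinVazirani1997].
* S. Aaronson, A. Ambainis, *The need for structure in quantum speedups*, Theory Comput. 10
  (2014), proof of Thm. 23 (p. 14: "`p_x(A)` depends only on some finite prefix `B` of `A`")
  [AaronsonAmbainis2014].
-/

noncomputable section

namespace Literature.Computability.QuantumComplexity

open Matrix _root_.Computability Literature.Computability.Complexity Literature.Computability.Cryptography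
  MeasureTheory

variable {G : QGateSet} {n m : ℕ}

/-- **Oracle locality of circuit families**: the acceptance probability on `x` reads only oracle
strings shorter than the width `|x| + ancillas |x|`. Deliberate dot-notation extension of
`Literature.Computability.Cryptography.QCircuitFamily`. [cite: BernsteinVazirani1997, §8 (oracle quantum machines)] -/
theorem _root_.Literature.Computability.Cryptography.QCircuitFamily.acceptProbOn_congr {A B : Language Bool}
    (F : QCircuitFamily G) (x : List Bool)
    (h : ∀ q : List Bool, q.length < x.length + F.ancillas x.length → (q ∈ A ↔ q ∈ B)) :
    F.acceptProbOn A x = F.acceptProbOn B x :=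
  QCircuit.acceptProb_congr h _ _

/-- The strings of length `< N`, as a finite set of strings. [folklore] -/
def shortStrings (N : ℕ) : Finset (List Bool) :=
  (Finset.range N).biUnion fun n => (Finset.univ : Finset (Fin n → Bool)).image List.ofFn

/-- Membership in `shortStrings`. [folklore] -/
theorem mem_shortStrings {N : ℕ} {q : List Bool} : q ∈ shortStrings N ↔ q.length < N := by
  simp only [shortStrings, Finset.mem_biUnion, Finset.mem_range, Finset.mem_image, Finset.mem_univ,
    true_and]
  constructor
  · rintro ⟨n, hn, f, rfl⟩; simpa using hn
  · intro hq; exact ⟨q.length, hq, fun i => q[i], by simp⟩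

/-- The acceptance probability, as a function of the oracle, factors through the finitely many
oracle bits on the short strings (`restrictBool` of `RandomOracleCylinders.lean`). [folklore] -/
theorem acceptProbOn_eq_of_restrictBool (F : QCircuitFamily G) (x : List Bool) {A B : Set (List Bool)}
    (h : restrictBool (shortStrings (x.length + F.ancillas x.length)) A =
      restrictBool (shortStrings (x.length + F.ancillas x.length)) B) :
    F.acceptProbOn A x = F.acceptProbOn B x := by
  refine QCircuitFamily.acceptProbOn_congr F x fun q hq => ?_
  have := congrFun h ⟨q, mem_shortStrings.2 hq⟩
  rw [restrictBool_apply, restrictBool_apply] at this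
  exact (@decide_eq_decide _ _ (Classical.propDecidable _) (Classical.propDecidable _)).1 this

/-- **The acceptance probability is a measurable function of the random oracle** (it factors
through the restriction to finitely many coordinates, a map out of a finite discrete space). [folklore] -/
theorem measurable_acceptProbOn (F : QCircuitFamily G) (x : List Bool) :
    Measurable fun A : Set (List Bool) => F.acceptProbOn A x := by
  classical
  set U := shortStrings (x.length + F.ancillas x.length) with hU
  -- factor through the restriction to `U`
  set g : (U → Bool) → ℝ := fun τ => F.acceptProbOn {q | ∃ h : q ∈ U, τ ⟨q, h⟩ = true} x with hg
  have hfac : (fun A : Set (List Bool) => F.acceptProbOn A x) = g ∘ restrictBool U := by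
    funext A
    simp only [Function.comp_apply, hg]
    refine acceptProbOn_eq_of_restrictBool F x (funext fun u => ?_)
    rw [restrictBool_apply, restrictBool_apply]
    apply (@decide_eq_decide _ _ (Classical.propDecidable _) (Classical.propDecidable _)).2
    simp only [Set.mem_setOf_eq]
    constructor
    · intro hu; exact ⟨u.2, (restrictBool_eq_true_iff U A u).2 hu⟩
    · rintro ⟨_, h⟩; exact (restrictBool_eq_true_iff U A u).1 h
  rw [hfac]
  exact (Measurable.of_discrete (f := g)).comp (measurable_restrictBool U)

/-- Events defined through the acceptance probability are determined by the short strings (hence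
measurable, `IsDetermined.measurableSet`, and counted by the bridge of
`RandomOracleCylinders.lean`). [folklore] -/
theorem isDetermined_acceptProbOn (F : QCircuitFamily G) (x : List Bool) (P : ℝ → Prop) :
    IsDetermined (shortStrings (x.length + F.ancillas x.length))
      {A : Set (List Bool) | P (F.acceptProbOn A x)} := fun _ _ h => by
  simp only [Set.mem_setOf_eq, acceptProbOn_eq_of_restrictBool F x h]

end Literature.Computability.QuantumComplexity

end
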